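import Summits.Ventures.CertifiedArithmetic.LowPrec.AttainP3109

/-!
# Corollary E1-attain, mixed formats: when a PRODUCT table never attains `u/(1+u)`

HONEST FRAMING (venture CertifiedArithmetic / cell `pub-lowprec`): certified error envelopes and
provably optimal rounding/accumulation schemes for low-precision formats under stated cost models;
every table by two implementations; no hardware or vendor claims.

THEOREMS-R1.md (cell `pub-lowprec`, enum seat) predicts for every `(X, Y, op, R)` key whether the
sharp normal-range relative error `u_R/(1+u_R)` of round-to-nearest is attained by some in-range
result (column "attained?" of sec 4/5; Corollary E1-attain). `Attain.lean` proves the NEVER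
direction for same-format products when `2^P + 1` is prime. This file states the criterion for two
operand formats and a third destination — attainment forces `(2^(P_R)+1) ∣ k_a · k_b` for the
integral significands, so a decidable search over `k_a < 2^(P_X)`, `k_b < 2^(P_Y)` settles it — and
instantiates it for the 10 product keys of the cell predicted "never attained" that are not
same-format-prime instances (`E4M3·E4M3 → binary16`: `2049 = 3·683`; `E4M3·E5M2`, `E5M2·E5M2`,
`binary8p3²`, `binary8p4·binary8p3` `→ binary16`; `E4M3·E5M2 → E4M3` and `binary8p4·binary8p3 →
binary8p4`: `17`; `binary8p5² → bfloat16`: `257`; the FNUZ E5M2 key as an alias of its `binary8p3f`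
twin). The ATTAINED direction (explicit witnesses, all sum keys and the remaining product keys) is
`AttainVerdictsOCP.lean` / `AttainVerdictsP3109.lean`. Parameter level: no table is enumerated.
-/

namespace Summit.Ventures.CertifiedArithmetic

open Literature.ComputerArithmetic.FloatingPoint
open Literature.ComputerArithmetic.FloatingPoint.MiniFloat
open Literature.ComputerArithmetic.FloatingPoint.Format

/-- MIXED-FORMAT NON-ATTAINMENT CRITERION (products): if `2^(P_R) + 1` divides no product
`k_a · k_b` of nonzero significands `k_a < 2^(P_X)`, `k_b < 2^(P_Y)`, then no product of an `X`
datum by a `Y` datum has relative rounding error `u_R/(1+u_R)` under round-to-nearest in the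
normal range of `R`: the sharp bound is STRICT there. Generalises `abs_errMul_lt_sharp_of_prime`
(same format, `2^P + 1` prime) to two operand formats and a third destination; the hypothesis is
decidable in the three precisions. [folklore; JeannerodRump2018 Thm 3.2 for the same-format
criterion] -/
theorem abs_sub_roundNE_mul_lt_sharp_of_forall {X Y R : Format}
    (h : ∀ ka < 2 ^ (X.manBits + 1), ∀ kb < 2 ^ (Y.manBits + 1),
      2 ^ (R.manBits + 1) + 1 ∣ ka * kb → ka * kb = 0)
    (a : MiniFloat X) (b : MiniFloat Y)
    (hlo : 2 ^ R.manBits * R.quantum ≤ |a.toRat * b.toRat|)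
    (hhi : |a.toRat * b.toRat| ≤ R.maxRat) :
    |a.toRat * b.toRat - (roundNE R (a.toRat * b.toRat)).toRat| <
      R.unitRoundoff / (1 + R.unitRoundoff) * |a.toRat * b.toRat| := by
  refine lt_of_le_of_ne (abs_sub_roundNE_le_sharp hlo hhi) fun heq => ?_
  have hx := abs_eq_sharp_imp hlo hhi heq
  set s := R.shift ⌊|a.toRat * b.toRat| / R.quantum⌋.toNat with hs
  have hprod : |a.toRat * b.toRat| =
      ((a.scaledMag * b.scaledMag : ℕ) : ℚ) * (2 : ℚ) ^ (X.qexp + Y.qexp) := by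
    rw [abs_mul, abs_toRat, abs_toRat]; unfold Format.quantum
    rw [zpow_add₀ (by norm_num : (2 : ℚ) ≠ 0)]; push_cast; ring
  have hrhs : (1 + R.unitRoundoff) * ((2 : ℚ) ^ (R.manBits + s) * R.quantum)
      = ((2 ^ (R.manBits + 1) + 1 : ℕ) : ℚ) * (2 : ℚ) ^ (R.qexp + s - 1) := by
    rw [Format.unitRoundoff_eq]; unfold Format.quantum
    have h2 : (2 : ℚ) ≠ 0 := by norm_num
    rw [show R.qexp + (s : ℤ) - 1 = R.qexp + ((s : ℤ) - 1) by ring, zpow_add₀ h2,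
      zpow_sub₀ h2, zpow_natCast, zpow_one, pow_add]
    push_cast; field_simp; ring
  rw [hprod, hrhs] at hx
  have hpow : 2 ^ (R.manBits + 1) + 1 = 2 * 2 ^ R.manBits + 1 := by rw [pow_succ]; ring
  have hodd : Odd (2 ^ (R.manBits + 1) + 1) := ⟨2 ^ R.manBits, by rw [hpow]⟩
  have hdvd := dvd_of_mul_zpow_eq hodd hx
  obtain ⟨-, ka, ja, hka, hka'⟩ := representable_iff.mp a.representable_scaledMag
  obtain ⟨-, kb, jb, hkb, hkb'⟩ := representable_iff.mp b.representable_scaledMag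
  have hfac : a.scaledMag * b.scaledMag = (ka * kb) * 2 ^ (ja + jb) := by rw [hka', hkb']; ring
  have hne : a.scaledMag * b.scaledMag ≠ 0 := by
    intro h0
    have h1 : |a.toRat * b.toRat| = 0 := by rw [hprod, h0]; simp
    rw [h1] at hlo
    have : (0 : ℚ) < 2 ^ R.manBits * R.quantum := by have := R.quantum_pos; positivity
    linarith
  rw [hfac] at hdvd hne
  have hcop2 : Nat.Coprime (2 ^ (R.manBits + 1) + 1) 2 := by
    rw [Nat.coprime_comm, Nat.Prime.coprime_iff_not_dvd Nat.prime_two]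
    intro h2; rw [hpow] at h2; omega
  have hcop : Nat.Coprime (2 ^ (R.manBits + 1) + 1) (2 ^ (ja + jb)) := Nat.Coprime.pow_right _ hcop2
  have hdvd' : 2 ^ (R.manBits + 1) + 1 ∣ ka * kb := Nat.Coprime.dvd_of_dvd_mul_right hcop hdvd
  have h0 := h ka hka kb hkb hdvd'
  exact hne (by rw [h0]; simp)

/-- `E4M3 * E4M3 → Binary16` (RNE): the sharp bound `u/(1+u) = 1/2049` is NEVER attained in the
normal range of `Binary16` — `2049` divides no product `k_a · k_b` of nonzero `k_a < 2^4`, `k_b <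
2^4` (kernel check of the criterion; THEOREMS-R1 sec 4/5 prediction "no"). -/
theorem E4M3_mul_E4M3_sharp_not_attained_in_Binary16
    (a : MiniFloat E4M3) (b : MiniFloat E4M3)
    (hlo : 2 ^ Binary16.manBits * Binary16.quantum ≤ |a.toRat * b.toRat|)
    (hhi : |a.toRat * b.toRat| ≤ Binary16.maxRat) :
    |a.toRat * b.toRat - (roundNE Binary16 (a.toRat * b.toRat)).toRat| <
      Binary16.unitRoundoff / (1 + Binary16.unitRoundoff) * |a.toRat * b.toRat| :=
  abs_sub_roundNE_mul_lt_sharp_of_forall (by decide) a b hlo hhi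

/-- `E4M3 * E5M2 → Binary16` (RNE): the sharp bound `u/(1+u) = 1/2049` is NEVER attained in the
normal range of `Binary16` — `2049` divides no product `k_a · k_b` of nonzero `k_a < 2^4`, `k_b <
2^3` (kernel check of the criterion; THEOREMS-R1 sec 4/5 prediction "no"). -/
theorem E4M3_mul_E5M2_sharp_not_attained_in_Binary16
    (a : MiniFloat E4M3) (b : MiniFloat E5M2)
    (hlo : 2 ^ Binary16.manBits * Binary16.quantum ≤ |a.toRat * b.toRat|)
    (hhi : |a.toRat * b.toRat| ≤ Binary16.maxRat) :
    |a.toRat * b.toRat - (roundNE Binary16 (a.toRat * b.toRat)).toRat| <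
      Binary16.unitRoundoff / (1 + Binary16.unitRoundoff) * |a.toRat * b.toRat| :=
  abs_sub_roundNE_mul_lt_sharp_of_forall (by decide) a b hlo hhi

/-- `E4M3 * E5M2 → E4M3` (RNE): the sharp bound `u/(1+u) = 1/17` is NEVER attained in the normal
range of `E4M3` — `17` divides no product `k_a · k_b` of nonzero `k_a < 2^4`, `k_b < 2^3` (kernel
check of the criterion; THEOREMS-R1 sec 4/5 prediction "no"). -/
theorem E4M3_mul_E5M2_sharp_not_attained_in_E4M3
    (a : MiniFloat E4M3) (b : MiniFloat E5M2)
    (hlo : 2 ^ E4M3.manBits * E4M3.quantum ≤ |a.toRat * b.toRat|)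
    (hhi : |a.toRat * b.toRat| ≤ E4M3.maxRat) :
    |a.toRat * b.toRat - (roundNE E4M3 (a.toRat * b.toRat)).toRat| <
      E4M3.unitRoundoff / (1 + E4M3.unitRoundoff) * |a.toRat * b.toRat| :=
  abs_sub_roundNE_mul_lt_sharp_of_forall (by decide) a b hlo hhi

/-- `E5M2 * E4M3 → Binary16` (RNE): the sharp bound `u/(1+u) = 1/2049` is NEVER attained in the
normal range of `Binary16` — `2049` divides no product `k_a · k_b` of nonzero `k_a < 2^3`, `k_b <
2^4` (kernel check of the criterion; THEOREMS-R1 sec 4/5 prediction "no"). -/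
theorem E5M2_mul_E4M3_sharp_not_attained_in_Binary16
    (a : MiniFloat E5M2) (b : MiniFloat E4M3)
    (hlo : 2 ^ Binary16.manBits * Binary16.quantum ≤ |a.toRat * b.toRat|)
    (hhi : |a.toRat * b.toRat| ≤ Binary16.maxRat) :
    |a.toRat * b.toRat - (roundNE Binary16 (a.toRat * b.toRat)).toRat| <
      Binary16.unitRoundoff / (1 + Binary16.unitRoundoff) * |a.toRat * b.toRat| :=
  abs_sub_roundNE_mul_lt_sharp_of_forall (by decide) a b hlo hhi

/-- `E5M2 * E5M2 → Binary16` (RNE): the sharp bound `u/(1+u) = 1/2049` is NEVER attained in the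
normal range of `Binary16` — `2049` divides no product `k_a · k_b` of nonzero `k_a < 2^3`, `k_b <
2^3` (kernel check of the criterion; THEOREMS-R1 sec 4/5 prediction "no"). -/
theorem E5M2_mul_E5M2_sharp_not_attained_in_Binary16
    (a : MiniFloat E5M2) (b : MiniFloat E5M2)
    (hlo : 2 ^ Binary16.manBits * Binary16.quantum ≤ |a.toRat * b.toRat|)
    (hhi : |a.toRat * b.toRat| ≤ Binary16.maxRat) :
    |a.toRat * b.toRat - (roundNE Binary16 (a.toRat * b.toRat)).toRat| <
      Binary16.unitRoundoff / (1 + Binary16.unitRoundoff) * |a.toRat * b.toRat| :=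
  abs_sub_roundNE_mul_lt_sharp_of_forall (by decide) a b hlo hhi

/-- `Binary8p3 * Binary8p3 → Binary16` (RNE): the sharp bound `u/(1+u) = 1/2049` is NEVER attained
in the normal range of `Binary16` — `2049` divides no product `k_a · k_b` of nonzero `k_a < 2^3`,
`k_b < 2^3` (kernel check of the criterion; THEOREMS-R1 sec 4/5 prediction "no"). -/
theorem Binary8p3_mul_Binary8p3_sharp_not_attained_in_Binary16
    (a : MiniFloat Binary8p3) (b : MiniFloat Binary8p3)
    (hlo : 2 ^ Binary16.manBits * Binary16.quantum ≤ |a.toRat * b.toRat|)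
    (hhi : |a.toRat * b.toRat| ≤ Binary16.maxRat) :
    |a.toRat * b.toRat - (roundNE Binary16 (a.toRat * b.toRat)).toRat| <
      Binary16.unitRoundoff / (1 + Binary16.unitRoundoff) * |a.toRat * b.toRat| :=
  abs_sub_roundNE_mul_lt_sharp_of_forall (by decide) a b hlo hhi

/-- `Binary8p3F * Binary8p3F → Binary16` (RNE): the sharp bound `u/(1+u) = 1/2049` is NEVER attained
in the normal range of `Binary16` — `2049` divides no product `k_a · k_b` of nonzero `k_a < 2^3`,
`k_b < 2^3` (kernel check of the criterion; THEOREMS-R1 sec 4/5 prediction "no"). -/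
theorem Binary8p3F_mul_Binary8p3F_sharp_not_attained_in_Binary16
    (a : MiniFloat Binary8p3F) (b : MiniFloat Binary8p3F)
    (hlo : 2 ^ Binary16.manBits * Binary16.quantum ≤ |a.toRat * b.toRat|)
    (hhi : |a.toRat * b.toRat| ≤ Binary16.maxRat) :
    |a.toRat * b.toRat - (roundNE Binary16 (a.toRat * b.toRat)).toRat| <
      Binary16.unitRoundoff / (1 + Binary16.unitRoundoff) * |a.toRat * b.toRat| :=
  abs_sub_roundNE_mul_lt_sharp_of_forall (by decide) a b hlo hhi

/-- `Binary8p4 * Binary8p3 → Binary16` (RNE): the sharp bound `u/(1+u) = 1/2049` is NEVER attained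
in the normal range of `Binary16` — `2049` divides no product `k_a · k_b` of nonzero `k_a < 2^4`,
`k_b < 2^3` (kernel check of the criterion; THEOREMS-R1 sec 4/5 prediction "no"). -/
theorem Binary8p4_mul_Binary8p3_sharp_not_attained_in_Binary16
    (a : MiniFloat Binary8p4) (b : MiniFloat Binary8p3)
    (hlo : 2 ^ Binary16.manBits * Binary16.quantum ≤ |a.toRat * b.toRat|)
    (hhi : |a.toRat * b.toRat| ≤ Binary16.maxRat) :
    |a.toRat * b.toRat - (roundNE Binary16 (a.toRat * b.toRat)).toRat| <
      Binary16.unitRoundoff / (1 + Binary16.unitRoundoff) * |a.toRat * b.toRat| :=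
  abs_sub_roundNE_mul_lt_sharp_of_forall (by decide) a b hlo hhi

/-- `Binary8p4 * Binary8p3 → Binary8p4` (RNE): the sharp bound `u/(1+u) = 1/17` is NEVER attained in
the normal range of `Binary8p4` — `17` divides no product `k_a · k_b` of nonzero `k_a < 2^4`, `k_b <
2^3` (kernel check of the criterion; THEOREMS-R1 sec 4/5 prediction "no"). -/
theorem Binary8p4_mul_Binary8p3_sharp_not_attained_in_Binary8p4
    (a : MiniFloat Binary8p4) (b : MiniFloat Binary8p3)
    (hlo : 2 ^ Binary8p4.manBits * Binary8p4.quantum ≤ |a.toRat * b.toRat|)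
    (hhi : |a.toRat * b.toRat| ≤ Binary8p4.maxRat) :
    |a.toRat * b.toRat - (roundNE Binary8p4 (a.toRat * b.toRat)).toRat| <
      Binary8p4.unitRoundoff / (1 + Binary8p4.unitRoundoff) * |a.toRat * b.toRat| :=
  abs_sub_roundNE_mul_lt_sharp_of_forall (by decide) a b hlo hhi

/-- `Binary8p5 * Binary8p5 → BFloat16` (RNE): the sharp bound `u/(1+u) = 1/257` is NEVER attained in
the normal range of `BFloat16` — `257` divides no product `k_a · k_b` of nonzero `k_a < 2^5`, `k_b <
2^5` (kernel check of the criterion; THEOREMS-R1 sec 4/5 prediction "no"). -/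
theorem Binary8p5_mul_Binary8p5_sharp_not_attained_in_BFloat16
    (a : MiniFloat Binary8p5) (b : MiniFloat Binary8p5)
    (hlo : 2 ^ BFloat16.manBits * BFloat16.quantum ≤ |a.toRat * b.toRat|)
    (hhi : |a.toRat * b.toRat| ≤ BFloat16.maxRat) :
    |a.toRat * b.toRat - (roundNE BFloat16 (a.toRat * b.toRat)).toRat| <
      BFloat16.unitRoundoff / (1 + BFloat16.unitRoundoff) * |a.toRat * b.toRat| :=
  abs_sub_roundNE_mul_lt_sharp_of_forall (by decide) a b hlo hhi

/-- FNUZ alias (same value set as the P3109 finite-domain twin): `FnuzE5M2 * FnuzE5M2 → Binary16`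
never attains `u/(1+u)`. -/
theorem FnuzE5M2_mul_FnuzE5M2_sharp_not_attained_in_Binary16
    (a : MiniFloat FnuzE5M2) (b : MiniFloat FnuzE5M2)
    (hlo : 2 ^ Binary16.manBits * Binary16.quantum ≤ |a.toRat * b.toRat|)
    (hhi : |a.toRat * b.toRat| ≤ Binary16.maxRat) :
    |a.toRat * b.toRat - (roundNE Binary16 (a.toRat * b.toRat)).toRat| <
      Binary16.unitRoundoff / (1 + Binary16.unitRoundoff) * |a.toRat * b.toRat| :=
  Binary8p3F_mul_Binary8p3F_sharp_not_attained_in_Binary16 a b hlo hhi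

end Summit.Ventures.CertifiedArithmetic
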